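import Literature.NumberTheory.Transcendental.KontsevichZagier
import Literature.NumberTheory.Transcendental.MZVSimplexRepProofs
import HarnessLib

/-!
# Multiple zeta values are Kontsevich–Zagier periods — proof of `isPeriod_multipleZeta`

Sibling proof file of `Literature.NumberTheory.Transcendental.KontsevichZagier` (D-0014: `Literature/`
is sorry-free; cited results are named facts `def X : Prop`, discharged by `theorem X_holds : X`),
next to `KontsevichZagierProofs.lean` (`log q`, `Γ(p/q)`), `KontsevichZagierZetaProofs.lean`
(`ζ(k)`) and `KontsevichZagierCountableProofs.lean`; kept separate because it needs the simplex
representation files `MZVSimplexRep*.lean`. It discharges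

* `Literature.NumberTheory.Transcendental.isPeriod_multipleZeta` — every multiple zeta value
  `ζ(s₁, …, s_k)` of an admissible index is an (effective) Kontsevich–Zagier period — as
  `isPeriod_multipleZeta_holds`.

## The source and this file

Kontsevich–Zagier (*Periods*, 2001, §1.1, first examples) list the multiple zeta values among the
periods, via Kontsevich's iterated-integral formula
`ζ(s₁, …, s_k) = ∫_{1 > t₁ > ⋯ > t_w > 0} ω_{ε₁}(t₁) ⋯ ω_{ε_w}(t_w)`, `ω₀(t) = dt/t`,
`ω₁(t) = dt/(1 - t)`, `w = s₁ + ⋯ + s_k`, `ε = 0^{s₁-1} 1 ⋯ 0^{s_k-1} 1` (Zagier, ECM 1994, §9):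
an absolutely convergent integral of a rational function with rational coefficients over a domain
in `ℝ^w` given by polynomial inequalities with rational coefficients, i.e. a period in the sense
of [Kontsevich–Zagier 2001, §1.1, Definition] = `Literature.NumberTheory.Transcendental.IsRealPeriod`.

All the ingredients are in the tree; this file only assembles them into the datum `(n, σ, p, q)`
of `IsRealPeriod`:
* the domain `σ = KZ.openOrderedSimplex w` is `ℚ`-semialgebraic
  (`KZ.isSemialgebraic_openOrderedSimplex`);
* the integrand is `p/q` with `p = 1`, `q = ∏ᵢ qᵢ`, `qᵢ = Xᵢ` (letter `0`) or `1 - Xᵢ`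
  (letter `1`) (`KZ.mzvIntegrand_eq_aeval_div_aeval`), and `q` does not vanish on `σ`
  (`KZ.aeval_prod_ne_zero_of_mem_openOrderedSimplex`);
* absolute convergence for admissible `s` (`KZ.mzvIntegrand_integrableOn_holds`);
* the value of the integral is `multipleZeta s` — Kontsevich's formula,
  `KZ.mzvRep_value_holds` (`MZVSimplexRepProofs.lean`).
A real number viewed in `ℂ` is a period iff it is a real period (`isPeriod_ofReal_iff`).

## References

* M. Kontsevich, D. Zagier, *Periods*, in: Mathematics Unlimited — 2001 and Beyond, Springer
  (2001), 771–808, §1.1. [KontsevichZagier2001]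
* D. Zagier, *Values of zeta functions and their applications*, First European Congress of
  Mathematics II, Progr. Math. 120 (1994), 497–512, §9. [Zagier1994]
-/

noncomputable section

open MeasureTheory MvPolynomial

namespace Literature.NumberTheory.Transcendental

/-- **Multiple zeta values are real periods.** For an admissible index `s` of weight `w`,
`ζ(s) = ∫_σ 1/q` with `σ = {1 > t₁ > ⋯ > t_w > 0}` the open ordered simplex (`ℚ`-semialgebraic)
and `q = ∏ᵢ qᵢ ∈ ℚ[t₁, …, t_w]`, `qᵢ ∈ {tᵢ, 1 - tᵢ}` read off the binary word of `s`,
non-vanishing on `σ`, the integral converging absolutely: the datum of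
`Literature.NumberTheory.Transcendental.IsRealPeriod`. The value is Kontsevich's formula
(`KZ.mzvRep_value_holds`). [Kontsevich–Zagier 2001, §1.1; Zagier 1994, §9]
[cite: KontsevichZagier2001, §1.1] -/
theorem isRealPeriod_multipleZeta {s : List ℕ} (hs : MZV.IsAdmissible s) :
    IsRealPeriod (multipleZeta s) := by
  have hint := KZ.mzvIntegrand_integrableOn_holds s hs
  have hval := KZ.mzvRep_value_holds s hs (KZ.mzvIntegrand_isSemialgebraicFunOn_holds s) hint
  rw [KZ.mzvRep_value_eq] at hval
  have hfun : KZ.mzvIntegrand s = fun t => aeval t (1 : MvPolynomial (Fin (MZV.weight s)) ℚ) /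
      aeval t (∏ i : Fin (MZV.weight s),
        (if (MZV.binaryWord s).getD i false then 1 - X i else X i :
          MvPolynomial (Fin (MZV.weight s)) ℚ)) :=
    funext (KZ.mzvIntegrand_eq_aeval_div_aeval s)
  rw [hfun] at hint hval
  exact ⟨MZV.weight s, KZ.openOrderedSimplex (MZV.weight s), 1, _,
    KZ.isSemialgebraic_openOrderedSimplex _,
    fun t ht => KZ.aeval_prod_ne_zero_of_mem_openOrderedSimplex s ht, hint, hval.symm⟩

/-- **periods.S06 — multiple zeta values are periods** (discharge of the named fact
`Literature.NumberTheory.Transcendental.isPeriod_multipleZeta`): for every admissible index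
`s = (s₁, …, s_k)` the multiple zeta value `ζ(s₁, …, s_k)`, viewed in `ℂ`, is an effective
Kontsevich–Zagier period, by the iterated-integral representation over the ordered simplex
(`isRealPeriod_multipleZeta`) and `isPeriod_ofReal_iff`. [Kontsevich–Zagier 2001, §1.1]
[cite: KontsevichZagier2001, §1.1] -/
theorem isPeriod_multipleZeta_holds : isPeriod_multipleZeta := fun _ hs =>
  isPeriod_ofReal_iff.2 (isRealPeriod_multipleZeta hs)

end Literature.NumberTheory.Transcendental
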